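import Mathlib
import Summits.Parity.BatemanHorn.Theses.PolynomialMobius
import Summits.Parity.BatemanHorn.Theorems.PolynomialMobiusPolyMobiusTailStubPairCorner
import Summits.Parity.BatemanHorn.Theorems.PolynomialMobiusPolyMobiusTailStubPairMiddle
import Summits.Parity.BatemanHorn.Theorems.PolynomialMobiusPolyMobiusTailStubPairBalanced

/-!
# Crux `PolyMobiusTail` (stmt-Parity-0870), line `eta-free-multilinear-window`:
# the WINDOW of the Möbius tail for LINEAR PAIRS (`k = 2`) — theorem-grade deliverable of the line

For every Bateman–Horn system of two members of degree ≤ 1 (e.g. the twin pair `(X, X+2)`, or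
`(q₁X+a₁, q₂X+a₂)`) some window `(x^{1−η}, x^{1+θ}]` of the Möbius tail is `o(x)`:
`Σ_{n≤x} Σ_{dᵢ∣fᵢ(n), x^{1−η} < d₀d₁ ≤ x^{1+θ}} μ(d₀)log d₀ μ(d₁)log d₁ = o(x)`.
Assembled from the three RANGE theorems by the size of `min(d₀,d₁)`:
CORNER `min ≤ x^{3/10}` (Bombieri–Vinogradov for `μ`, `stub_pair_corner`), MIDDLE `x^{3/10} < min ≤ x^{12/25}`
(Linnik dispersion + Weil + Möbius PNT, `stub_pair_middle`), BALANCED `x^{12/25} < min`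
(Duke–Friedlander–Iwaniec bilinear Kloosterman fractions, `stub_pair_balanced`), with
`θ = η = min(c_corner, c_middle, c_balanced, 1/2)`.  Head: the registered stub `stub_window_linear_pair`.
-/

open scoped BigOperators
open Filter Finset Polynomial Asymptotics

namespace Summit.Parity.BatemanHorn.Theorems.PolyMobiusTail.EtaFreeWindow

open Literature.NumberTheory.Sieve

/-- Pointwise range split of the pair-window summand by the size of `m = min(d₀,d₁)` (`1 ≤ x`):
`[A ∧ B] = [A ∧ B ∧ m ≤ x^{3/10}] + [A ∧ B ∧ x^{3/10} < m ≤ x^{12/25}] + [A ∧ B ∧ x^{12/25} < m]`. -/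
theorem pair_summand_split {x : ℕ} (hx : (1 : ℝ) ≤ x) (A B : Prop) [Decidable A] [Decidable B] (m : ℕ)
    (w : ℝ) :
    (if A ∧ B then w else 0) =
      (if A ∧ B ∧ (m : ℝ) ≤ (x : ℝ) ^ (3 / 10 : ℝ) then w else 0) +
      (if A ∧ B ∧ ((x : ℝ) ^ (3 / 10 : ℝ) < m ∧ (m : ℝ) ≤ (x : ℝ) ^ (12 / 25 : ℝ)) then w else 0) +
      (if A ∧ B ∧ (x : ℝ) ^ (12 / 25 : ℝ) < m then w else 0) := by
  have hmono : (x : ℝ) ^ (3 / 10 : ℝ) ≤ (x : ℝ) ^ (12 / 25 : ℝ) :=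
    Real.rpow_le_rpow_of_exponent_le hx (by norm_num)
  by_cases hP : A ∧ B
  · obtain ⟨hA, hB⟩ := hP
    by_cases h1 : (m : ℝ) ≤ (x : ℝ) ^ (3 / 10 : ℝ)
    · have h2 : ¬ ((x : ℝ) ^ (3 / 10 : ℝ) < m ∧ (m : ℝ) ≤ (x : ℝ) ^ (12 / 25 : ℝ)) :=
        fun h => (not_lt.mpr h1) h.1
      have h3 : ¬ (x : ℝ) ^ (12 / 25 : ℝ) < m := not_lt.mpr (h1.trans hmono)
      rw [if_pos ⟨hA, hB⟩, if_pos ⟨hA, hB, h1⟩, if_neg (fun h => h2 h.2.2), if_neg (fun h => h3 h.2.2)]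
      ring
    · push Not at h1
      by_cases h2 : (m : ℝ) ≤ (x : ℝ) ^ (12 / 25 : ℝ)
      · have h3 : ¬ (x : ℝ) ^ (12 / 25 : ℝ) < m := not_lt.mpr h2
        rw [if_pos ⟨hA, hB⟩, if_neg (fun h => (not_le.mpr h1) h.2.2), if_pos ⟨hA, hB, h1, h2⟩,
          if_neg (fun h => h3 h.2.2)]
        ring
      · push Not at h2
        rw [if_pos ⟨hA, hB⟩, if_neg (fun h => (not_le.mpr h1) h.2.2),
          if_neg (fun h => (not_le.mpr h2) h.2.2.2), if_pos ⟨hA, hB, h2⟩]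
        ring
  · rw [if_neg hP, if_neg (fun h => hP ⟨h.1, h.2.1⟩), if_neg (fun h => hP ⟨h.1, h.2.1⟩),
      if_neg (fun h => hP ⟨h.1, h.2.1⟩)]
    ring

/-- **The linear PAIR window (registered stub `stub_window_linear_pair`, line eta-free-multilinear-window).**
For a Bateman–Horn system of two members of degree ≤ 1 some window `(x^{1−η}, x^{1+θ}]` of the Möbius
tail is `o(x)` — from `stub_pair_corner` (`σ = 3/10`), `stub_pair_middle` (`σ₁ = 3/10`, `σ₂ = 12/25`) and
`stub_pair_balanced` (`σ = 12/25`) by the value of `min(d₀,d₁)`, with `θ = η = min(c₁, c₂, c₃, 1/2)`. -/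
theorem stub_window_linear_pair : ∀ (k : ℕ) (f : Fin k → ℤ[X]), IsBatemanHornSystem f → k = 2 →
    (∀ i, (f i).natDegree ≤ 1) →
    ∃ θ : ℝ, 0 < θ ∧ θ < 1 ∧ ∃ η : ℝ, 0 < η ∧ η < 1 ∧
      (fun x : ℕ => ∑ n ∈ Finset.Icc 1 x,
        ∑ d ∈ Fintype.piFinset (fun i => (((f i).eval (n : ℤ)).toNat).divisors),
          if (x : ℝ) ^ (1 - η) < ∏ i, (d i : ℝ) ∧ ∏ i, (d i : ℝ) ≤ (x : ℝ) ^ (1 + θ) then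
            ∏ i, ((ArithmeticFunction.moebius (d i) : ℝ) * Real.log (d i)) else 0)
        =o[atTop] fun x : ℕ => (x : ℝ) := by
  intro k f hf hk hlin
  subst hk
  obtain ⟨c₁, hc₁, h₁⟩ := stub_pair_corner f hf hlin (3 / 10) (by norm_num) (by norm_num)
  obtain ⟨c₂, hc₂, h₂⟩ :=
    stub_pair_middle f hf hlin (3 / 10) (12 / 25) (by norm_num) (by norm_num) (by norm_num)
  obtain ⟨c₃, hc₃, h₃⟩ := stub_pair_balanced f hf hlin (12 / 25) (by norm_num) (by norm_num)
  set c : ℝ := min (min c₁ c₂) (min c₃ (1 / 2)) with hc_def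
  have hc0 : 0 < c := lt_min (lt_min hc₁ hc₂) (lt_min hc₃ (by norm_num))
  have hcc₁ : c ≤ c₁ := (min_le_left _ _).trans (min_le_left _ _)
  have hcc₂ : c ≤ c₂ := (min_le_left _ _).trans (min_le_right _ _)
  have hcc₃ : c ≤ c₃ := (min_le_right _ _).trans (min_le_left _ _)
  have hc1 : c < 1 := lt_of_le_of_lt ((min_le_right _ _).trans (min_le_right _ _)) (by norm_num)
  refine ⟨c, hc0, hc1, c, hc0, hc1, ?_⟩
  have H := ((h₁ c c hc0 hcc₁ hc0 hcc₁).add (h₂ c c hc0 hcc₂ hc0 hcc₂)).add (h₃ c c hc0 hcc₃ hc0 hcc₃)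
  refine H.congr_left fun x => ?_
  rw [← Finset.sum_add_distrib, ← Finset.sum_add_distrib]
  refine Finset.sum_congr rfl fun n hn => ?_
  rw [← Finset.sum_add_distrib, ← Finset.sum_add_distrib]
  refine Finset.sum_congr rfl fun d _ => ?_
  have hx1 : (1 : ℝ) ≤ (x : ℝ) := by
    have h := Finset.mem_Icc.mp hn
    exact_mod_cast h.1.trans h.2
  exact (pair_summand_split hx1 ((x : ℝ) ^ (1 - c) < ∏ i, (d i : ℝ))
    (∏ i, (d i : ℝ) ≤ (x : ℝ) ^ (1 + c)) (min (d 0) (d 1))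
    (∏ i, ((ArithmeticFunction.moebius (d i) : ℝ) * Real.log (d i)))).symm

end Summit.Parity.BatemanHorn.Theorems.PolyMobiusTail.EtaFreeWindow
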